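import Mathlib.Topology.Homotopy.Lifting
import Mathlib.Topology.Covering.Basic
import Mathlib.Topology.Connected.LocallyPathConnected
import Mathlib.AlgebraicTopology.FundamentalGroupoid.SimplyConnected
import HarnessLib

/-!
# Covering maps: subsingleton fibres, preimages of `π₁`-absorbing sets, sheets over simply
# connected subspaces

Point-set / homotopy-lifting bookkeeping for covering maps `F : X → Y` (Mathlib's `IsCoveringMap`,
Hatcher 2002, §1.3), proved from Mathlib's path/homotopy lifting and monodromy:

* `injective_of_isCoveringMap_of_subsingleton_fiber` — over a path connected base, one fibre with
  at most one point forces `F` injective (monodromy is a bijection of fibres);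
* `simplyConnectedSpace_of_isCoveringMap_of_subsingleton_fiber` — if moreover `X` is simply
  connected and `F` onto, `Y ≃ₜ X` is simply connected;
* `isPathConnected_preimage_of_isCoveringMap` — the preimage of a path connected set `A` which
  absorbs paths up to homotopy (every path with ends in `A` is homotopic rel ends to one inside `A`,
  e.g. a deformation retract) is path connected, for `X` path connected;
* `exists_path_homotopic_of_retractionHomotopy` — a deformation retraction onto `A` makes `A`
  absorb paths up to homotopy;
* `exists_lift_isOpen_range` — through every point over `ι t₀`, an embedding `ι : T → Y` of a simply
  connected locally path connected space lifts (lifting criterion, Hatcher Prop. 1.33), and the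
  lift's image — one sheet — is OPEN in `F ⁻¹' (range ι)`.

First use: the core reduction of crux `AhHadamardFilling` of `SmoothPoincare4` (the far complement of
a collar lifted to the universal Riemannian covering). Everything is proved; no definitions.

## References

* A. Hatcher, *Algebraic Topology* (2002), §1.3: Props. 1.30–1.34 (lifting), Prop. 1.39.
  [HatcherAT2002]
-/

noncomputable section

open Set Function Topology

namespace Literature.Topology.CoveringSpaces

variable {X Y : Type*} [TopologicalSpace X] [TopologicalSpace Y] {F : X → Y}

/-- **A covering map of a path connected space with one subsingleton fibre is injective**
(monodromy along a path from the base point of that fibre is a bijection of fibres — Hatcher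
2002, Prop. 1.30 ff.; Mathlib's `IsCoveringMap.monodromy_bijective`). [folklore] -/
theorem injective_of_isCoveringMap_of_subsingleton_fiber [PathConnectedSpace Y]
    (hF : IsCoveringMap F) {y₀ : Y} (h : (F ⁻¹' {y₀}).Subsingleton) : Injective F := by
  intro a b hab
  set γ : Path y₀ (F a) := PathConnectedSpace.somePath y₀ (F a) with hγ
  have hbij := hF.monodromy_bijective (⟦γ⟧ : Path.Homotopic.Quotient y₀ (F a))
  have hsub : Subsingleton (F ⁻¹' {y₀}) := (Set.subsingleton_coe _).2 h
  have hsub' : Subsingleton (F ⁻¹' {F a}) := (Equiv.ofBijective _ hbij).symm.subsingleton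
  exact congrArg Subtype.val (hsub'.elim ⟨a, rfl⟩ ⟨b, hab.symm⟩)

/-- **Simple connectivity of the base of a covering by a simply connected space with a
subsingleton fibre**: if a covering map `F : X → Y` from a simply connected space onto a path
connected space has one fibre with at most one point, then `F` is a homeomorphism and `Y` is simply
connected (Hatcher 2002, Prop. 1.39 for the universal cover; here directly: monodromy makes every
fibre a point, and a bijective covering map is a homeomorphism). [cite: HatcherAT2002, Prop. 1.39] -/
theorem simplyConnectedSpace_of_isCoveringMap_of_subsingleton_fiber [SimplyConnectedSpace X]
    [PathConnectedSpace Y] (hF : IsCoveringMap F) (hsurj : Surjective F) {y₀ : Y}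
    (h : (F ⁻¹' {y₀}).Subsingleton) : SimplyConnectedSpace Y := by
  have hinj := injective_of_isCoveringMap_of_subsingleton_fiber hF h
  -- a bijective covering map is a homeomorphism (covering maps are open)
  set e : X ≃ₜ Y :=
    (Equiv.ofBijective F ⟨hinj, hsurj⟩).toHomeomorphOfContinuousOpen hF.continuous hF.isOpenMap
    with he
  exact e.symm.toHomotopyEquiv.simplyConnectedSpace

/-- **The preimage of a `π₁`-absorbing path connected set under a covering map is path
connected.** Let `F : X → Y` be a covering map with `X` path connected and `A ⊆ Y` path connected
such that every path of `Y` with end points in `A` is homotopic (rel end points) to a path inside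
`A` (e.g. `A` a deformation retract of `Y`; in K1, `A = K_t` and `Y = W` retracts onto `K_t`
along the collar). Then `F ⁻¹' A` is path connected: lift a path of `A` from a base point, then
join the end point to any other point of its fibre by projecting a path of `X`, pushing the loop
into `A` and lifting back (Mathlib's `IsCoveringMap.liftPath_apply_one_eq_of_homotopicRel`).
[folklore] -/
theorem isPathConnected_preimage_of_isCoveringMap [PathConnectedSpace X]
    (hF : IsCoveringMap F) {A : Set Y} (hA : IsPathConnected A)
    (habs : ∀ ⦃a b : Y⦄ (γ : Path a b), a ∈ A → b ∈ A →
      ∃ γ' : Path a b, (∀ t, γ' t ∈ A) ∧ γ.Homotopic γ')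
    (hne : (F ⁻¹' A).Nonempty) : IsPathConnected (F ⁻¹' A) := by
  obtain ⟨e₀, he₀⟩ := hne
  refine ⟨e₀, he₀, fun e he ↦ ?_⟩
  -- (1) a path of `A` from `F e₀` to `F e`, lifted from `e₀`, ends at a point `e₁` over `F e`
  obtain ⟨β, hβ⟩ := hA.joinedIn (F e₀) he₀ (F e) he
  have hβ0 : (β : C(unitInterval, Y)) 0 = F e₀ := β.source
  set Γ : C(unitInterval, X) := hF.liftPath (β : C(unitInterval, Y)) e₀ hβ0 with hΓdef
  have hΓlift : ∀ t, F (Γ t) = β t := fun t ↦ congr_fun (hF.liftPath_lifts _ e₀ hβ0) t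
  have hΓ0 : Γ 0 = e₀ := hF.liftPath_zero _ e₀ hβ0
  set e₁ : X := Γ 1 with he₁def
  have he₁ : F e₁ = F e := by rw [he₁def, hΓlift 1]; exact β.target
  have hΓA : ∀ t, Γ t ∈ F ⁻¹' A := fun t ↦ by
    show F (Γ t) ∈ A
    rw [hΓlift t]
    exact hβ t
  have h1 : JoinedIn (F ⁻¹' A) e₀ e₁ := ⟨⟨Γ, hΓ0, rfl⟩, hΓA⟩
  -- (2) from `e₁` to `e`: project a path of `X`, push it into `A`, lift it back
  set α₁ : Path e₁ e := PathConnectedSpace.somePath e₁ e with hα₁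
  set α : Path (F e₁) (F e) := α₁.map hF.continuous with hα
  obtain ⟨α', hα'A, hαα'⟩ := habs α (by rw [he₁]; exact he) he
  have hα0 : α.toContinuousMap 0 = F e₁ := α.source
  have hα'0 : α'.toContinuousMap 0 = F e₁ := α'.source
  set Γ' : C(unitInterval, X) := hF.liftPath α'.toContinuousMap e₁ hα'0 with hΓ'def
  have hΓ'lift : ∀ t, F (Γ' t) = α' t := fun t ↦ congr_fun (hF.liftPath_lifts _ e₁ hα'0) t
  have hΓ'0 : Γ' 0 = e₁ := hF.liftPath_zero _ e₁ hα'0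
  have hαlift : hF.liftPath α.toContinuousMap e₁ hα0 = α₁.toContinuousMap := by
    symm
    rw [hF.eq_liftPath_iff']
    exact ⟨rfl, α₁.source⟩
  have hΓ'1 : Γ' 1 = e := by
    have h := hF.liftPath_apply_one_eq_of_homotopicRel hαα' e₁ hα0 hα'0
    rw [hαlift] at h
    rw [hΓ'def, ← h]
    exact α₁.target
  have hΓ'A : ∀ t, Γ' t ∈ F ⁻¹' A := fun t ↦ by
    show F (Γ' t) ∈ A
    rw [hΓ'lift t]
    exact hα'A t
  have h2 : JoinedIn (F ⁻¹' A) e₁ e := ⟨⟨Γ', hΓ'0, hΓ'1⟩, hΓ'A⟩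
  exact h1.trans h2


/-- **A set onto which the space retracts by a homotopy fixing it absorbs paths up to
homotopy**: if `H : [0,1] × Y → Y` satisfies `H(0, ·) = id`, `H(1, ·) ∈ A` and `H(s, a) = a` for
`a ∈ A` (a deformation retraction of `Y` onto `A`, e.g. of the filling `W` onto a far complement
`K_t` along the collar), then every path with end points in `A` is homotopic rel end points to a
path inside `A` (namely `H(1, γ)`, through `H(s, γ)`). This is the hypothesis `habs` of
`isPathConnected_preimage_of_isCoveringMap`. [folklore] -/
theorem exists_path_homotopic_of_retractionHomotopy {A : Set Y} (H : C(unitInterval × Y, Y))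
    (h0 : ∀ y, H (0, y) = y) (h1 : ∀ y, H (1, y) ∈ A)
    (hA : ∀ (s : unitInterval), ∀ a ∈ A, H (s, a) = a) ⦃a b : Y⦄ (γ : Path a b) (ha : a ∈ A)
    (hb : b ∈ A) : ∃ γ' : Path a b, (∀ t, γ' t ∈ A) ∧ γ.Homotopic γ' := by
  have hsrc : ∀ s : unitInterval, H (s, γ 0) = a := fun s ↦ by rw [γ.source]; exact hA s a ha
  have htgt : ∀ s : unitInterval, H (s, γ 1) = b := fun s ↦ by rw [γ.target]; exact hA s b hb
  let γ' : Path a b :=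
    { toFun := fun t ↦ H (1, γ t)
      continuous_toFun := H.continuous.comp (continuous_const.prodMk γ.continuous)
      source' := hsrc 1
      target' := htgt 1 }
  refine ⟨γ', fun t ↦ h1 (γ t), ⟨?_⟩⟩
  exact
    { toFun := fun q ↦ H (q.1, γ q.2)
      continuous_toFun :=
        H.continuous.comp (continuous_fst.prodMk (γ.continuous.comp continuous_snd))
      map_zero_left := fun t ↦ h0 (γ t)
      map_one_left := fun t ↦ rfl
      prop' := fun s t ht ↦ by
        rcases ht with rfl | ht
        · exact (hsrc s).trans γ.source.symm
        · rw [Set.mem_singleton_iff] at ht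
          subst ht
          exact (htgt s).trans γ.target.symm }


/-- **Sheets over a simply connected subspace.** Let `F : X → Y` be a covering map and
`ι : T → Y` a topological embedding of a simply connected, locally path connected space (in K1:
the slice `σ ↦ Φ(σ, t)` of the homotopy 4-sphere). Through every point `e` over `ι t₀` there is a
continuous lift `s : T → X` of `ι` (Mathlib's lifting criterion
`IsCoveringMap.existsUnique_continuousMap_lifts`), and its image — one sheet over `ι(T)` — is
OPEN in `F ⁻¹' (range ι)`: near a point of the sheet, `s` is the section of the evenly covered
neighbourhood through it (uniqueness of lifts on a path component). With `T` compact the sheets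
are the compact open pieces of `F ⁻¹' (range ι)` fed to the convex-body boundary theorem in the
intended proof of K1. [folklore] -/
theorem exists_lift_isOpen_range (hF : IsCoveringMap F) {T : Type*} [TopologicalSpace T]
    [SimplyConnectedSpace T] [LocallyPathConnectedSpace T] {ι : T → Y}
    (hι : Topology.IsEmbedding ι) {t₀ : T} {e : X} (he : F e = ι t₀) :
    ∃ s : C(T, X), F ∘ s = ι ∧ s t₀ = e ∧
      IsOpen (((↑) : F ⁻¹' range ι → X) ⁻¹' range s) := by
  obtain ⟨s, ⟨hs0, hslift⟩, -⟩ :=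
    hF.existsUnique_continuousMap_lifts ⟨ι, hι.continuous⟩ t₀ e he
  have hsl : ∀ σ, F (s σ) = ι σ := fun σ ↦ congr_fun hslift σ
  refine ⟨s, hslift, hs0, ?_⟩
  rw [isOpen_iff_mem_nhds]
  rintro ⟨x, hx⟩ ⟨σ₀, hσ₀⟩
  change s σ₀ = x at hσ₀
  subst hσ₀
  -- an evenly covered neighbourhood `U` of `F (s σ₀)` and the sheet index `i₀` of `s σ₀`
  obtain ⟨hdisc, U, hyU, hUo, hFUo, H, hH⟩ := hF (F (s σ₀))
  haveI := hdisc
  set i₀ := (H ⟨s σ₀, hyU⟩).2 with hi₀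
  -- the sheet `Sl` of index `i₀` over `U`, an open subset of `X`
  set Sl : Set X := Subtype.val '' ((fun z : F ⁻¹' U ↦ (H z).2) ⁻¹' {i₀}) with hSl
  have hSlo : IsOpen Sl :=
    hFUo.isOpenMap_subtype_val _
      ((isOpen_discrete {i₀}).preimage (continuous_snd.comp H.continuous))
  have hmemSl : ∀ {z : X}, z ∈ Sl ↔ ∃ h : F z ∈ U, (H ⟨z, h⟩).2 = i₀ := by
    intro z
    constructor
    · rintro ⟨⟨z', hz'⟩, hz'i, rfl⟩
      exact ⟨hz', hz'i⟩
    · rintro ⟨h, hi⟩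
      exact ⟨⟨z, h⟩, hi, rfl⟩
  have hHsymm : ∀ (z : X) (h : F z ∈ U), (H ⟨z, h⟩).2 = i₀ →
      (H.symm (⟨F z, h⟩, i₀) : X) = z := by
    intro z h hi
    have h1 : H ⟨z, h⟩ = (⟨F z, h⟩, i₀) := Prod.ext (Subtype.ext (hH ⟨z, h⟩)) hi
    have h2 := congrArg H.symm h1
    rw [H.symm_apply_apply] at h2
    exact (congrArg Subtype.val h2).symm
  have hFsymm : ∀ (u : U), F (H.symm (u, i₀) : X) = u := by
    intro u
    have := hH (H.symm (u, i₀))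
    rw [H.apply_symm_apply] at this
    exact this.symm
  -- the path component `Vp` of `σ₀` in `ι ⁻¹' U`, open and preconnected
  set V' : Set T := ι ⁻¹' U with hV'
  have hV'o : IsOpen V' := hUo.preimage hι.continuous
  have hσ₀V' : σ₀ ∈ V' := by
    show ι σ₀ ∈ U
    rw [← hsl σ₀]
    exact hyU
  set Vp : Set T := pathComponentIn V' σ₀ with hVp
  have hVpo : IsOpen Vp := hV'o.pathComponentIn σ₀
  have hVpV' : Vp ⊆ V' := pathComponentIn_subset
  have hσ₀Vp : σ₀ ∈ Vp := mem_pathComponentIn_self hσ₀V'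
  haveI : PreconnectedSpace Vp :=
    Subtype.preconnectedSpace (isPathConnected_pathComponentIn hσ₀V').isConnected.isPreconnected
  -- on `Vp`, the lift `s` is the sheet section `σ ↦ H⁻¹ (ι σ, i₀)`
  set g₁ : Vp → X := fun v ↦ s v with hg₁
  set g₂ : Vp → X := fun v ↦ (H.symm (⟨ι v, hVpV' v.2⟩, i₀) : X) with hg₂
  have hg₁c : Continuous g₁ := s.continuous.comp continuous_subtype_val
  have hg₂c : Continuous g₂ := by
    refine continuous_subtype_val.comp (H.symm.continuous.comp ?_)
    exact ((hι.continuous.comp continuous_subtype_val).subtype_mk _).prodMk continuous_const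
  have hFg : F ∘ g₁ = F ∘ g₂ := by
    funext v
    simp only [comp_apply, hg₁, hg₂]
    rw [hsl, hFsymm]
  have hg0 : g₁ ⟨σ₀, hσ₀Vp⟩ = g₂ ⟨σ₀, hσ₀Vp⟩ := by
    simp only [hg₁, hg₂]
    have h := hHsymm (s σ₀) hyU rfl
    have hsub : (⟨F (s σ₀), hyU⟩ : U) = ⟨ι σ₀, hVpV' hσ₀Vp⟩ := Subtype.ext (hsl σ₀)
    rw [hsub] at h
    exact h.symm
  have hEq : g₁ = g₂ := hF.eq_of_comp_eq hg₁c hg₂c hFg ⟨σ₀, hσ₀Vp⟩ hg0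
  -- the neighbourhood: points of the sheet `Sl` lying over `ι(Vp) = O ∩ range ι`
  obtain ⟨O, hOo, hO⟩ := hι.toIsInducing.isOpen_iff.1 hVpo
  have hNo : IsOpen {w : F ⁻¹' range ι | (w : X) ∈ Sl ∧ F w ∈ O} :=
    (hSlo.preimage continuous_subtype_val).inter
      (hOo.preimage (hF.continuous.comp continuous_subtype_val))
  refine mem_nhds_iff.2 ⟨_, ?_, hNo, ?_⟩
  · rintro ⟨w, hw⟩ ⟨hwSl, hwO⟩
    obtain ⟨τ, hτ⟩ := hw
    have hτVp : τ ∈ Vp := by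
      rw [← hO]
      show ι τ ∈ O
      rw [hτ]
      exact hwO
    obtain ⟨h, hi⟩ := hmemSl.1 hwSl
    have h1 := hHsymm w h hi
    have h2 : g₁ ⟨τ, hτVp⟩ = g₂ ⟨τ, hτVp⟩ := congr_fun hEq _
    simp only [hg₁, hg₂] at h2
    refine ⟨τ, ?_⟩
    show s τ = w
    rw [h2]
    have hsub : (⟨ι τ, hVpV' hτVp⟩ : U) = ⟨F w, h⟩ := Subtype.ext hτ
    rw [hsub]
    exact h1
  · refine ⟨hmemSl.2 ⟨hyU, rfl⟩, ?_⟩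
    show F (s σ₀) ∈ O
    have : σ₀ ∈ ι ⁻¹' O := by
      rw [hO]
      exact hσ₀Vp
    rw [hsl]
    exact this


end Literature.Topology.CoveringSpaces

end
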